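import Literature.Topology.FourManifolds.RegularLevelMorseData
import Literature.Topology.FourManifolds.RegularSublevelSet
import Literature.Topology.FourManifolds.MorseBirthLemma
import HarnessLib

/-!
# Charts of a regular level from smooth parametrisations, and Morse data in them

Topic `Literature/Topology/FourManifolds`; tool (T1) of step G of a Morse-theoretic construction
of Gay–Kirby's trisection for the fact seat
`provefact-Literature.Topology.FourManifolds.exists_isBalancedGKTrisection` (Gay–Kirby 2016,
Thm. 4 via §4, Lemma 14).  Everything in this file is **proved**; the definitions (the
parametrisation data, the lifted parametrisation, the chart) are explicit.

A regular level `N = g⁻¹(c)` of a smooth function on a manifold `M` (`Literature.RegularLevel`)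
carries the slice-chart smooth structure.  To *compute* with a function `Φ : N → ℝ` near a point
one wants charts of `N` adapted to the situation: a smooth map `ψ` from an open set `O` of the
model space into `M` landing in the level, with a smooth left inverse `λ` defined near its image
(`IsRegularLevel.Param`).  Then `λ ∘ incl` is a chart of `N` with inverse the lift of `ψ`
(`Param.chart`), it lies in the **maximal atlas** of `N` (`Param.chart_mem_maximalAtlas`:
both it and its inverse are smooth, Mathlib's `IsManifold.mem_maximalAtlas_iff_contMDiffOn`;
smoothness into the level by `ContMDiffAt.iff_comp_isImmersionAt` for the embedding `incl`),
and the Morse data of `Φ` at `ψ u` are those of the Euclidean function `Φ ∘ lift ψ` at `u`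
(`Param.isMCriticalPt_iff`, `Param.morseData`: criticality, nondegeneracy of the Hessian and
the Morse index, by the chart-independence of these notions, `nondegenerate_mhessian_iff`,
`morseIndex_eq_sigNeg_hessianInChart`).

## References

* M. W. Hirsch, *Differential Topology* (1976), Ch. 1 §3, Thm. 3.2. [HirschDT1976]
* J. Milnor, *Morse theory* (1963), §2. [Milnor1963]
-/

open scoped Manifold ContDiff Topology
open Set Function Filter

noncomputable section

universe u

namespace Literature.Topology.FourManifolds

/-- Local notation: `𝔼 n` is the model Euclidean space `EuclideanSpace ℝ (Fin n)`. -/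
local notation "𝔼 " n:arg => EuclideanSpace ℝ (Fin n)

variable {n : ℕ} {M : Type u} [TopologicalSpace M] [ChartedSpace (𝔼 (n + 2)) M]
  [IsManifold (𝓡 (n + 2)) ∞ M] {g : M → ℝ} {c : ℝ}

/-- **Parametrisation data for a regular level**: a smooth map `ψ` on an open set `O` of the
model space into `M`, landing in the level `g = c`, with a smooth left inverse `λ` on an open
set `V ⊇ ψ(O)` whose level part is exactly `ψ(O)`. [folklore] -/
structure IsRegularLevel.Param (hg : IsRegularLevel (𝓡 (n + 2)) g c) where
  /-- The parameter domain. -/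
  O : Set (𝔼 (n + 1))
  isOpen_O : IsOpen O
  /-- The parametrisation. -/
  ψ : 𝔼 (n + 1) → M
  contMDiffOn_ψ : ContMDiffOn (𝓡 (n + 1)) (𝓡 (n + 2)) ∞ ψ O
  apply_ψ : ∀ u ∈ O, g (ψ u) = c
  /-- An open set containing the image. -/
  V : Set M
  isOpen_V : IsOpen V
  ψ_mem : ∀ u ∈ O, ψ u ∈ V
  /-- The left inverse. -/
  lam : M → 𝔼 (n + 1)
  contMDiffOn_lam : ContMDiffOn (𝓡 (n + 2)) (𝓡 (n + 1)) ∞ lam V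
  lam_ψ : ∀ u ∈ O, lam (ψ u) = u
  ψ_lam : ∀ z ∈ V, g z = c → lam z ∈ O ∧ ψ (lam z) = z

namespace IsRegularLevel.Param

variable {hg : IsRegularLevel (𝓡 (n + 2)) g c} (P : hg.Param) [Nonempty (RegularLevel hg)]

open Classical in
/-- The parametrisation lifted to the level (junk off `O`). [folklore] -/
def lift (u : 𝔼 (n + 1)) : RegularLevel hg :=
  if hu : u ∈ P.O then ⟨P.ψ u, P.apply_ψ u hu⟩ else Classical.arbitrary _

omit [IsManifold (𝓡 (n + 2)) ∞ M] in
/-- On `O` the lift is `ψ`. [folklore] -/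
theorem incl_lift {u : 𝔼 (n + 1)} (hu : u ∈ P.O) : RegularLevel.incl hg (P.lift u) = P.ψ u := by
  simp only [lift, dif_pos hu]

omit [IsManifold (𝓡 (n + 2)) ∞ M] in
/-- `incl ∘ lift = ψ` near a point of `O`. [folklore] -/
theorem incl_comp_lift_eventuallyEq {u : 𝔼 (n + 1)} (hu : u ∈ P.O) :
    (RegularLevel.incl hg ∘ P.lift) =ᶠ[𝓝 u] P.ψ := by
  filter_upwards [P.isOpen_O.mem_nhds hu] with v hv
  exact P.incl_lift hv

/-- **The lift is smooth on `O` as a map into the level.** [cite: HirschDT1976, Ch. 1 §3, Thm. 3.2] -/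
theorem contMDiffAt_lift {u : 𝔼 (n + 1)} (hu : u ∈ P.O) : ContMDiffAt (𝓡 (n + 1)) (𝓡 (n + 1)) ∞ P.lift u := by
  have hι := RegularLevel.isSmoothEmbedding_incl hg
  have hcomp : ContMDiffAt (𝓡 (n + 1)) (𝓡 (n + 2)) ∞ (RegularLevel.incl hg ∘ P.lift) u :=
    ((P.contMDiffOn_ψ u hu).contMDiffAt (P.isOpen_O.mem_nhds hu)).congr_of_eventuallyEq (P.incl_comp_lift_eventuallyEq hu)
  have hcont : ContinuousAt P.lift u := by
    rw [hι.isEmbedding.isInducing.continuousAt_iff]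
    exact hcomp.continuousAt
  exact (ContMDiffAt.iff_comp_isImmersionAt (hι.isImmersion.isImmersionAt _)).2 ⟨hcont, hcomp⟩

/-- **The chart of the level defined by the parametrisation**: `λ ∘ incl` on `incl⁻¹(V)`, with
inverse the lift of `ψ` on `O`. [cite: HirschDT1976, Ch. 1 §3, Thm. 3.2] -/
def chart : OpenPartialHomeomorph (RegularLevel hg) (𝔼 (n + 1)) where
  toFun y := P.lam y.1
  invFun := P.lift
  source := RegularLevel.incl hg ⁻¹' P.V
  target := P.O
  map_source' y hy := (P.ψ_lam y.1 hy y.2).1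
  map_target' u hu := by
    show (P.lift u).1 ∈ P.V
    rw [show (P.lift u).1 = RegularLevel.incl hg (P.lift u) from rfl, P.incl_lift hu]
    exact P.ψ_mem u hu
  left_inv' y hy := by
    apply Subtype.ext
    show (P.lift (P.lam y.1)).1 = y.1
    rw [show (P.lift (P.lam y.1)).1 = RegularLevel.incl hg (P.lift (P.lam y.1)) from rfl,
      P.incl_lift (P.ψ_lam y.1 hy y.2).1]
    exact (P.ψ_lam y.1 hy y.2).2
  right_inv' u hu := by
    show P.lam (P.lift u).1 = u
    rw [show (P.lift u).1 = RegularLevel.incl hg (P.lift u) from rfl, P.incl_lift hu]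
    exact P.lam_ψ u hu
  open_source := P.isOpen_V.preimage continuous_subtype_val
  open_target := P.isOpen_O
  continuousOn_toFun := P.contMDiffOn_lam.continuousOn.comp continuous_subtype_val.continuousOn fun _ hy => hy
  continuousOn_invFun := by
    rw [(RegularLevel.isEmbedding_incl hg).continuousOn_iff]
    exact P.contMDiffOn_ψ.continuousOn.congr fun u hu => P.incl_lift hu

omit [IsManifold (𝓡 (n + 2)) ∞ M] in
/-- The chart as a map. [folklore] -/
@[simp] theorem chart_apply (y : RegularLevel hg) : P.chart y = P.lam y.1 := rfl

omit [IsManifold (𝓡 (n + 2)) ∞ M] in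
/-- The inverse of the chart. [folklore] -/
@[simp] theorem chart_symm_apply (u : 𝔼 (n + 1)) : P.chart.symm u = P.lift u := rfl

omit [IsManifold (𝓡 (n + 2)) ∞ M] in
/-- The source of the chart. [folklore] -/
theorem chart_source : P.chart.source = RegularLevel.incl hg ⁻¹' P.V := rfl

omit [IsManifold (𝓡 (n + 2)) ∞ M] in
/-- The target of the chart. [folklore] -/
theorem chart_target : P.chart.target = P.O := rfl

omit [IsManifold (𝓡 (n + 2)) ∞ M] in
/-- The point `lift u` lies in the source. [folklore] -/
theorem lift_mem_source {u : 𝔼 (n + 1)} (hu : u ∈ P.O) : P.lift u ∈ P.chart.source :=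
  P.chart.map_target hu

/-- **The chart lies in the maximal atlas of the level** (it and its inverse are smooth).
[cite: HirschDT1976, Ch. 1 §3, Thm. 3.2] -/
theorem chart_mem_maximalAtlas : P.chart ∈ IsManifold.maximalAtlas (𝓡 (n + 1)) ∞ (RegularLevel hg) := by
  rw [IsManifold.mem_maximalAtlas_iff_contMDiffOn]
  constructor
  · exact P.contMDiffOn_lam.comp (RegularLevel.contMDiff_incl hg).contMDiffOn fun _ hy => hy
  · intro u hu
    exact (P.contMDiffAt_lift hu).contMDiffWithinAt

/-! ### Morse data in the parametrisation -/

variable {Φ : RegularLevel hg → ℝ}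

omit [IsManifold (𝓡 (n + 2)) ∞ M] in
/-- `Φ ∘ chart⁻¹ = Φ ∘ lift`. [folklore] -/
theorem comp_chart_symm : Φ ∘ P.chart.symm = Φ ∘ P.lift := rfl

/-- **Criticality in the parametrisation**: `Φ` is critical at `ψ u` iff `D(Φ ∘ lift ψ)(u) = 0`.
[cite: Milnor1963, §2] -/
theorem isMCriticalPt_iff {u : 𝔼 (n + 1)} (hu : u ∈ P.O) (hΦ : MDifferentiableAt (𝓡 (n + 1)) 𝓘(ℝ, ℝ) Φ (P.lift u)) :
    IsMCriticalPt (𝓡 (n + 1)) Φ (P.lift u) ↔ fderiv ℝ (Φ ∘ P.lift) u = 0 := by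
  have he := P.chart_mem_maximalAtlas
  have h := isMCriticalPt_iff_fderiv_comp_symm_eq_zero (I := 𝓡 (n + 1)) (contMDiffOn_of_mem_maximalAtlas he)
    (contMDiffOn_symm_of_mem_maximalAtlas he) (P.lift_mem_source hu) hΦ
  rw [h, chart_apply, show (P.lift u).1 = RegularLevel.incl hg (P.lift u) from rfl, P.incl_lift hu, P.lam_ψ u hu]
  rfl

omit [IsManifold (𝓡 (n + 2)) ∞ M] in
/-- The chart Hessian of `Φ` in the parametrisation chart is `D²(Φ ∘ lift ψ)`. [cite: Milnor1963, §2] -/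
theorem hessianInChart_chart_apply (u : 𝔼 (n + 1)) (hu : u ∈ P.O) (v w : 𝔼 (n + 1)) :
    hessianInChart (𝓡 (n + 1)) P.chart Φ (P.lift u) v w = fderiv ℝ (fderiv ℝ (Φ ∘ P.lift)) u v w := by
  rw [RegularLevel.hessianInChart_apply_eq, chart_apply,
    show (P.lift u).1 = RegularLevel.incl hg (P.lift u) from rfl, P.incl_lift hu, P.lam_ψ u hu]
  rfl

/-- **Morse data in the parametrisation**: at a critical point `ψ u` of `Φ` (of class `C²`
there), the Hessian of `Φ` is nondegenerate iff that of `Φ ∘ lift ψ` at `u` is, and the Morse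
indices agree. [cite: Milnor1963, §2] -/
theorem morseData {u : 𝔼 (n + 1)} (hu : u ∈ P.O) (hΦ : ContMDiffAt (𝓡 (n + 1)) 𝓘(ℝ, ℝ) 2 Φ (P.lift u))
    (hcrit : IsMCriticalPt (𝓡 (n + 1)) Φ (P.lift u)) :
    ((mhessian (𝓡 (n + 1)) Φ (P.lift u)).Nondegenerate ↔ (mhessian (𝓡 (n + 1)) (Φ ∘ P.lift) u).Nondegenerate) ∧
      morseIndex (𝓡 (n + 1)) Φ (P.lift u) = morseIndex (𝓡 (n + 1)) (Φ ∘ P.lift) u := by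
  have he := P.chart_mem_maximalAtlas
  have he2 : P.chart ∈ IsManifold.maximalAtlas (𝓡 (n + 1)) 2 (RegularLevel hg) :=
    IsManifold.maximalAtlas_subset_of_le (by norm_cast) he
  have hB : hessianInChart (𝓡 (n + 1)) P.chart Φ (P.lift u) = mhessian (𝓡 (n + 1)) (Φ ∘ P.lift) u := by
    refine LinearMap.ext fun v => LinearMap.ext fun w => ?_
    rw [P.hessianInChart_chart_apply u hu, MorseBirth.mhessian_model_apply]
  constructor
  · rw [nondegenerate_mhessian_iff hΦ hcrit he2 (P.lift_mem_source hu), hB]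
  · rw [morseIndex_eq_sigNeg_hessianInChart hΦ hcrit he2 (P.lift_mem_source hu), hB]; rfl

/-- `Φ ∘ lift` is `C²` at `u` when `Φ` is `C²` at `ψ u`. [folklore] -/
theorem contMDiffAt_comp_lift {u : 𝔼 (n + 1)} (hu : u ∈ P.O) {m : WithTop ℕ∞} (hm : m ≤ ∞)
    (hΦ : ContMDiffAt (𝓡 (n + 1)) 𝓘(ℝ, ℝ) m Φ (P.lift u)) :
    ContMDiffAt (𝓡 (n + 1)) 𝓘(ℝ, ℝ) m (Φ ∘ P.lift) u :=
  hΦ.comp u ((P.contMDiffAt_lift hu).of_le hm)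

end IsRegularLevel.Param

end Literature.Topology.FourManifolds

end
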